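import Literature.Analysis.Fourier.VaalerWeightPoissonSums
import Mathlib.Analysis.SpecialFunctions.Stirling
import Mathlib.Analysis.SumIntegralComparisons
import HarnessLib

/-!
# Ramaré's dual kernel `j(y) = 2∫_y^1 φ(u) du/u` for Vaaler's weight and the bound
# `Σ_{m ≤ α} j(m/α) ≤ α − log α + (5 − log π)`

Continuation of `VaalerWeightPoissonSums.lean` (Vaaler's weight
`Φ(u) = πu(1−u)cot(πu) + u`, passed as the hypothesis `hΦ`).  Ramaré's second approximate formula
for `L(1,χ)` (Acta Arith. 100 (2001), Proposition 2 / (1.9)) has, on the dual side, the kernel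
`j(t) = 2∫_{|t|}^1 (π(1−u)cot(πu) + 1) du = 2∫_{|t|}^1 φ(u) du/u`.  Definition-free as before, we use

* `hJ : J = fun y => 2∫_y^1 Φ(min(u,1))/u du` — equal to `j(y)` for `0 < y ≤ 1` (`vaalerJ_eq`) and to
  `0` for `y ≥ 1` (`vaalerJ_eq_zero`, since `Φ(1) = 0`); this form is differentiable on all of
  `(0,∞)` with `J'(y) = −2Φ(min(y,1))/y` (`hasDerivAt_vaalerJ`), which is what the `δ`-derivative
  argument of `RamareLOneEvenSmoothing.lean` needs;
* `hR : R = fun y => ∫_{min(y,1)}^1 (1 − Φ(u))/u du` — the defect in `J(y) = −2 log y − 2R(y)`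
  (`vaalerJ_eq_log`; Ramaré's Lemma 7 upper bound `j(t) ≤ −2 log|t|` is `R ≥ 0`).

Main results: `R` is continuous, non-increasing, `0 ≤ R ≤ 5/2` on `[0,∞)` and `∫₀¹ R = 1/2`
(`integral_vaalerR`, i.e. `∫₀¹ j = 1`); and the **dual sum bound** `sum_vaalerJ_le`:
for `α ≥ 1` and every `M`,

  `Σ_{m < M} J((m+1)/α) ≤ α − log α + (5 − log π)`,

from Stirling's lower bound for `log ⌊α⌋!` (Mathlib `Stirling.le_log_factorial_stirling`) and the
Riemann-sum bound `Σ_{m ≤ α} R(m/α) ≥ α/2 − 5/2` (Mathlib `AntitoneOn.integral_le_sum`).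

Deviation from print.  Ramaré (§VI p. 262) bounds `Σ_{m ≤ δq} j(m/(δq))` through Lemma 10
(a convexity inequality of Louboutin) and writes `≤ δq − (log 2π − 1 + log δq)`; from his Lemma 7
(`j(t) ≥ −2 log|t| − 2(log 2π − 1)`) and Lemma 10 one actually gets the constant `+(log 2π − 1)`,
not `−(log 2π − 1)` (a sign slip; the printed inequality is nevertheless true numerically).  We avoid
both Lemma 10 and the value of the constant: the cruder `5 − log π` proved here suffices for
Corollary 1 (even characters) because the small conductors are covered by Louboutin's bound.

## References

* O. Ramaré, *Approximate formulae for L(1,χ)*, Acta Arith. 100 (2001) 245–266: (1.9) p. 247,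
  Lemma 7 p. 253, Lemma 15 p. 259, §VI p. 262. [cite: Ramare2001LOneApproximateFormulae, Lemma 7]
* J. D. Vaaler, *Some extremal functions in Fourier analysis*, Bull. AMS 12 (1985) 183–216,
  Theorem 6. [cite: Vaaler1985, Thm. 6]
-/

noncomputable section

open Real Filter Topology Set MeasureTheory intervalIntegral
open scoped Nat

namespace Literature.Analysis.Fourier

variable {Φ J R : ℝ → ℝ}

/-! ## The integrand `(1 − Φ(u))/u` and its primitive `R(y) = ∫_{min(y,1)}^1 (1 − Φ(u)) du/u` -/

section Weight

/-- `Φ` is continuous at interior points of `[0,1]`. [cite: Vaaler1985, Thm. 6] -/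
theorem continuousAt_vaalerPhi
    (hΦ : Φ = fun u => Real.cos (π * u) / (Real.sinc (π * u) + Real.sinc (π * (1 - u))) + u)
    {u : ℝ} (hu : u ∈ Ioo (0:ℝ) 1) : ContinuousAt Φ u :=
  (continuousOn_vaalerPhi hΦ).continuousAt (Icc_mem_nhds hu.1 hu.2)

/-- `0 ≤ (1 − Φ(u))/u ≤ 5/2` on `[0,1]` (the value at `u = 0` is `0` by `x/0 = 0`).
[cite: Ramare2001LOneApproximateFormulae, Lemma 7 p. 253] -/
theorem one_sub_vaalerPhi_div_mem
    (hΦ : Φ = fun u => Real.cos (π * u) / (Real.sinc (π * u) + Real.sinc (π * (1 - u))) + u)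
    {u : ℝ} (hu : u ∈ Icc (0:ℝ) 1) : 0 ≤ (1 - Φ u) / u ∧ (1 - Φ u) / u ≤ 5 / 2 := by
  rcases hu.1.eq_or_lt with h | h
  · rw [← h, div_zero]; norm_num
  · have := one_sub_vaalerPhi_div_le hΦ ⟨h, hu.2⟩
    exact ⟨this.1, this.2.2⟩

/-- `u ↦ (1 − Φ(u))/u` is continuous on `[0,1]` (at `0` because `(1 − Φ(u))/u ≤ π²u/2`).
[cite: Ramare2001LOneApproximateFormulae, Lemma 7 p. 253] -/
theorem continuousOn_one_sub_vaalerPhi_div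
    (hΦ : Φ = fun u => Real.cos (π * u) / (Real.sinc (π * u) + Real.sinc (π * (1 - u))) + u) :
    ContinuousOn (fun u => (1 - Φ u) / u) (Icc (0:ℝ) 1) := by
  have hIoc : ContinuousOn (fun u => (1 - Φ u) / u) (Ioc (0:ℝ) 1) :=
    (continuousOn_const.sub ((continuousOn_vaalerPhi hΦ).mono Ioc_subset_Icc_self)).div
      continuousOn_id fun x hx => hx.1.ne'
  intro u hu
  rcases hu.1.eq_or_lt with h0 | h0
  · subst h0
    show Tendsto (fun u => (1 - Φ u) / u) (𝓝[Icc 0 1] 0) (𝓝 ((1 - Φ 0) / 0))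
    rw [div_zero]
    refine tendsto_of_tendsto_of_tendsto_of_le_of_le' tendsto_const_nhds
      (h := fun u : ℝ => π ^ 2 * u / 2) ?_ ?_ ?_
    · have : Tendsto (fun u : ℝ => π ^ 2 * u / 2) (𝓝 0) (𝓝 (π ^ 2 * 0 / 2)) :=
        ((continuous_const.mul continuous_id).div_const _).tendsto 0
      rw [mul_zero, zero_div] at this
      exact this.mono_left nhdsWithin_le_nhds
    · filter_upwards [self_mem_nhdsWithin] with u hu
      exact (one_sub_vaalerPhi_div_mem hΦ hu).1
    · have h2 : Iio (1 / 2 : ℝ) ∈ 𝓝[Icc (0:ℝ) 1] 0 :=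
        mem_nhdsWithin_of_mem_nhds (Iio_mem_nhds (by norm_num))
      filter_upwards [self_mem_nhdsWithin, h2] with u hu hu2
      rcases hu.1.eq_or_lt with h | h
      · rw [← h, div_zero, mul_zero, zero_div]
      · exact (one_sub_vaalerPhi_div_le hΦ ⟨h, hu.2⟩).2.1 (le_of_lt hu2)
  · exact (hIoc u ⟨h0, hu.2⟩).mono_of_mem_nhdsWithin
      (mem_nhdsWithin.2 ⟨Ioi 0, isOpen_Ioi, h0, fun x hx => ⟨hx.1, hx.2.2⟩⟩)

/-- `R(y) = ∫_y^1 (1 − Φ(u)) du/u` for `y ≤ 1`. [cite: Ramare2001LOneApproximateFormulae, Lemma 7 p. 253] -/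
theorem vaalerR_eq_of_le_one (hR : R = fun y => ∫ u in (min y 1)..1, (1 - Φ u) / u)
    {y : ℝ} (hy : y ≤ 1) : R y = ∫ u in y..1, (1 - Φ u) / u := by
  rw [hR]; simp only [min_eq_left hy]

/-- `R(y) = 0` for `y ≥ 1`. [cite: Ramare2001LOneApproximateFormulae, Lemma 7 p. 253] -/
theorem vaalerR_eq_zero (hR : R = fun y => ∫ u in (min y 1)..1, (1 - Φ u) / u)
    {y : ℝ} (hy : 1 ≤ y) : R y = 0 := by
  rw [hR]; simp only [min_eq_right hy, intervalIntegral.integral_same]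

/-- `R ≥ 0` on `[0, ∞)`. [cite: Ramare2001LOneApproximateFormulae, Lemma 7 p. 253] -/
theorem vaalerR_nonneg
    (hΦ : Φ = fun u => Real.cos (π * u) / (Real.sinc (π * u) + Real.sinc (π * (1 - u))) + u)
    (hR : R = fun y => ∫ u in (min y 1)..1, (1 - Φ u) / u) {y : ℝ} (hy : 0 ≤ y) : 0 ≤ R y := by
  rcases le_or_gt y 1 with h1 | h1
  · rw [vaalerR_eq_of_le_one hR h1]
    exact intervalIntegral.integral_nonneg h1 fun u hu =>
      (one_sub_vaalerPhi_div_mem hΦ ⟨hy.trans hu.1, hu.2⟩).1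
  · rw [vaalerR_eq_zero hR h1.le]

/-- `R ≤ 5/2` on `[0, ∞)`. [cite: Ramare2001LOneApproximateFormulae, Lemma 7 p. 253] -/
theorem vaalerR_le
    (hΦ : Φ = fun u => Real.cos (π * u) / (Real.sinc (π * u) + Real.sinc (π * (1 - u))) + u)
    (hR : R = fun y => ∫ u in (min y 1)..1, (1 - Φ u) / u) {y : ℝ} (hy : 0 ≤ y) : R y ≤ 5 / 2 := by
  rcases le_or_gt y 1 with h1 | h1
  · rw [vaalerR_eq_of_le_one hR h1]
    calc ∫ u in y..1, (1 - Φ u) / u ≤ ∫ _ in y..1, (5 / 2 : ℝ) := by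
          refine intervalIntegral.integral_mono_on h1 ?_ intervalIntegrable_const fun u hu =>
            (one_sub_vaalerPhi_div_mem hΦ ⟨hy.trans hu.1, hu.2⟩).2
          exact ((continuousOn_one_sub_vaalerPhi_div hΦ).mono
            (Icc_subset_Icc hy le_rfl)).intervalIntegrable_of_Icc h1
      _ = 5 / 2 * (1 - y) := by rw [intervalIntegral.integral_const, smul_eq_mul]; ring
      _ ≤ 5 / 2 := by nlinarith
  · rw [vaalerR_eq_zero hR h1.le]; norm_num

/-- `R` is non-increasing on `[0, ∞)`. [cite: Ramare2001LOneApproximateFormulae, Lemma 7 p. 253] -/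
theorem vaalerR_antitoneOn
    (hΦ : Φ = fun u => Real.cos (π * u) / (Real.sinc (π * u) + Real.sinc (π * (1 - u))) + u)
    (hR : R = fun y => ∫ u in (min y 1)..1, (1 - Φ u) / u) : AntitoneOn R (Ici (0:ℝ)) := by
  intro y hy y' hy' hyy'
  have hy0 : 0 ≤ y := hy
  have hy0' : 0 ≤ y' := hy'
  rcases le_or_gt y' 1 with h1 | h1
  · have hy1 : y ≤ 1 := hyy'.trans h1
    rw [vaalerR_eq_of_le_one hR h1, vaalerR_eq_of_le_one hR hy1]
    have hint : ∀ a b, a ∈ Icc (0:ℝ) 1 → b ∈ Icc (0:ℝ) 1 →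
        IntervalIntegrable (fun u => (1 - Φ u) / u) volume a b := fun a b ha hb =>
      ((continuousOn_one_sub_vaalerPhi_div hΦ).mono (uIcc_subset_Icc ha hb)).intervalIntegrable
    have hadd := intervalIntegral.integral_add_adjacent_intervals (hint y y' ⟨hy0, hy1⟩ ⟨hy0', h1⟩)
      (hint y' 1 ⟨hy0', h1⟩ ⟨zero_le_one, le_rfl⟩)
    have hnn : 0 ≤ ∫ u in y..y', (1 - Φ u) / u :=
      intervalIntegral.integral_nonneg hyy' fun u hu =>
        (one_sub_vaalerPhi_div_mem hΦ ⟨hy0.trans hu.1, hu.2.trans h1⟩).1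
    linarith
  · rw [vaalerR_eq_zero hR h1.le]; exact vaalerR_nonneg hΦ hR hy0

/-- `R` is continuous on `[0, ∞)`. [cite: Ramare2001LOneApproximateFormulae, Lemma 7 p. 253] -/
theorem continuousOn_vaalerR
    (hΦ : Φ = fun u => Real.cos (π * u) / (Real.sinc (π * u) + Real.sinc (π * (1 - u))) + u)
    (hR : R = fun y => ∫ u in (min y 1)..1, (1 - Φ u) / u) : ContinuousOn R (Ici (0:ℝ)) := by
  have hint : IntegrableOn (fun u => (1 - Φ u) / u) (uIcc (0:ℝ) 1) volume := by
    rw [uIcc_of_le zero_le_one]; exact (continuousOn_one_sub_vaalerPhi_div hΦ).integrableOn_Icc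
  have h1 := intervalIntegral.continuousOn_primitive_interval_left hint
  rw [uIcc_of_le zero_le_one] at h1
  rw [hR]
  exact h1.comp (continuous_id.min continuous_const).continuousOn fun y hy =>
    ⟨le_min hy zero_le_one, min_le_right _ _⟩

/-- **`∫₀¹ R = 1/2`** (`= ∫₀¹ (1 − Φ)`, by parts). [cite: Ramare2001LOneApproximateFormulae, Lemma 7 p. 253 («∫₀¹ j = 1»)] -/
theorem integral_vaalerR
    (hΦ : Φ = fun u => Real.cos (π * u) / (Real.sinc (π * u) + Real.sinc (π * (1 - u))) + u)
    (hR : R = fun y => ∫ u in (min y 1)..1, (1 - Φ u) / u) : ∫ y in (0:ℝ)..1, R y = 1 / 2 := by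
  set g : ℝ → ℝ := fun u => (1 - Φ u) / u with hg
  have hgc : ContinuousOn g (Icc 0 1) := continuousOn_one_sub_vaalerPhi_div hΦ
  have hΦc := continuousOn_vaalerPhi hΦ
  have h1Φc : ContinuousOn (fun u => 1 - Φ u) (Icc 0 1) := continuousOn_const.sub hΦc
  have hgi : ∀ {a b : ℝ}, a ∈ Icc (0:ℝ) 1 → b ∈ Icc (0:ℝ) 1 → IntervalIntegrable g volume a b :=
    fun ha hb => (hgc.mono (uIcc_subset_Icc ha hb)).intervalIntegrable
  have hΦi : ∀ {a b : ℝ}, a ∈ Icc (0:ℝ) 1 → b ∈ Icc (0:ℝ) 1 →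
      IntervalIntegrable (fun u => 1 - Φ u) volume a b :=
    fun ha hb => (h1Φc.mono (uIcc_subset_Icc ha hb)).intervalIntegrable
  have h01 : (1:ℝ) ∈ Icc (0:ℝ) 1 := ⟨zero_le_one, le_rfl⟩
  -- the primitive `F(y) = y ∫_y^1 g − ∫_y^1 (1 − Φ)` has `F' = ∫_y^1 g`
  have hderiv : ∀ y ∈ Ioo (0:ℝ) 1, HasDerivAt
      (fun y => y * (∫ u in y..1, g u) - ∫ u in y..1, (1 - Φ u)) (∫ u in y..1, g u) y := by
    intro y hy
    have hy' : y ∈ Icc (0:ℝ) 1 := ⟨hy.1.le, hy.2.le⟩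
    have h1 : HasDerivAt (fun y => ∫ u in y..1, g u) (-g y) y :=
      intervalIntegral.integral_hasDerivAt_left (hgi hy' h01)
        ((hgc.mono Ioo_subset_Icc_self).stronglyMeasurableAtFilter isOpen_Ioo y hy)
        (hgc.continuousAt (Icc_mem_nhds hy.1 hy.2))
    have h2 : HasDerivAt (fun y => ∫ u in y..1, (1 - Φ u)) (-(1 - Φ y)) y :=
      intervalIntegral.integral_hasDerivAt_left (hΦi hy' h01)
        ((h1Φc.mono Ioo_subset_Icc_self).stronglyMeasurableAtFilter isOpen_Ioo y hy)
        (h1Φc.continuousAt (Icc_mem_nhds hy.1 hy.2))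
    have h3 : HasDerivAt (fun y => y * (∫ u in y..1, g u) - ∫ u in y..1, (1 - Φ u))
        (1 * (∫ u in y..1, g u) + y * (-g y) - (-(1 - Φ y))) y :=
      ((hasDerivAt_id' y).mul h1).sub h2
    refine h3.congr_deriv ?_
    have hy0 : y ≠ 0 := hy.1.ne'
    simp only [hg]
    field_simp
    ring
  have hp1 : ContinuousOn (fun y => ∫ u in y..1, g u) (Icc 0 1) := by
    have hint : IntegrableOn g (uIcc (0:ℝ) 1) volume := by
      rw [uIcc_of_le zero_le_one]; exact hgc.integrableOn_Icc
    have := intervalIntegral.continuousOn_primitive_interval_left hint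
    rwa [uIcc_of_le zero_le_one] at this
  have hp2 : ContinuousOn (fun y => ∫ u in y..1, (1 - Φ u)) (Icc 0 1) := by
    have hint : IntegrableOn (fun u => 1 - Φ u) (uIcc (0:ℝ) 1) volume := by
      rw [uIcc_of_le zero_le_one]; exact h1Φc.integrableOn_Icc
    have := intervalIntegral.continuousOn_primitive_interval_left hint
    rwa [uIcc_of_le zero_le_one] at this
  have hcontF : ContinuousOn (fun y => y * (∫ u in y..1, g u) - ∫ u in y..1, (1 - Φ u)) (Icc 0 1) :=
    (continuousOn_id.mul hp1).sub hp2
  have hftc := intervalIntegral.integral_eq_sub_of_hasDerivAt_of_le zero_le_one hcontF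
    (fun y hy => hderiv y hy) (hp1.intervalIntegrable_of_Icc zero_le_one)
  have h1Φ : ∫ u in (0:ℝ)..1, (1 - Φ u) = 1 - 1 / 2 := by
    rw [intervalIntegral.integral_sub intervalIntegrable_const
      ((hΦc.mono (uIcc_subset_Icc ⟨le_rfl, zero_le_one⟩ h01)).intervalIntegrable),
      intervalIntegral.integral_const, integral_vaalerPhi hΦ, smul_eq_mul]; ring
  have hcongr : ∫ y in (0:ℝ)..1, R y = ∫ y in (0:ℝ)..1, (∫ u in y..1, g u) :=
    intervalIntegral.integral_congr fun y hy => by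
      rw [uIcc_of_le zero_le_one] at hy
      exact vaalerR_eq_of_le_one hR hy.2
  rw [hcongr, hftc]
  simp only [intervalIntegral.integral_same, mul_zero, zero_mul, sub_zero, zero_sub, h1Φ]
  norm_num

end Weight

/-! ## The dual kernel `J(y) = 2∫_y^1 Φ(min(u,1)) du/u` -/

section Dual

/-- `u ↦ Φ(min(u,1))` is continuous on `[0, ∞)`. [cite: Vaaler1985, Thm. 6] -/
theorem continuousOn_vaalerPhi_min
    (hΦ : Φ = fun u => Real.cos (π * u) / (Real.sinc (π * u) + Real.sinc (π * (1 - u))) + u) :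
    ContinuousOn (fun u => Φ (min u 1)) (Ici (0:ℝ)) :=
  (continuousOn_vaalerPhi hΦ).comp (continuous_id.min continuous_const).continuousOn
    fun _ hu => ⟨le_min hu zero_le_one, min_le_right _ _⟩

/-- The integrand `Φ(min(u,1))/u` of `J` is continuous on `(0, ∞)`. [cite: Ramare2001LOneApproximateFormulae, (1.9) p. 247] -/
theorem continuousOn_vaalerJIntegrand
    (hΦ : Φ = fun u => Real.cos (π * u) / (Real.sinc (π * u) + Real.sinc (π * (1 - u))) + u) :
    ContinuousOn (fun u => Φ (min u 1) / u) (Ioi (0:ℝ)) :=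
  ((continuousOn_vaalerPhi_min hΦ).mono Ioi_subset_Ici_self).div continuousOn_id
    fun _ hu => ne_of_gt hu

/-- `J(y) = 0` for `y ≥ 1`. [cite: Ramare2001LOneApproximateFormulae, (1.9) p. 247] -/
theorem vaalerJ_eq_zero
    (hΦ : Φ = fun u => Real.cos (π * u) / (Real.sinc (π * u) + Real.sinc (π * (1 - u))) + u)
    (hJ : J = fun y => 2 * ∫ u in y..1, Φ (min u 1) / u) {y : ℝ} (hy : 1 ≤ y) : J y = 0 := by
  rw [hJ]; simp only
  rw [intervalIntegral.integral_congr (g := fun _ => (0:ℝ)) ?_]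
  · simp
  · intro u hu
    rw [uIcc_of_ge hy] at hu
    simp only
    rw [min_eq_right hu.1, (vaalerPhi_zero_one hΦ).2, zero_div]

/-- `J(y) = 2∫_y^1 Φ(u) du/u` for `0 < y ≤ 1`. [cite: Ramare2001LOneApproximateFormulae, (1.9) p. 247] -/
theorem vaalerJ_eq
    (hJ : J = fun y => 2 * ∫ u in y..1, Φ (min u 1) / u) {y : ℝ} (hy : y ≤ 1) :
    J y = 2 * ∫ u in y..1, Φ u / u := by
  rw [hJ]; simp only
  congr 1
  refine intervalIntegral.integral_congr fun u hu => ?_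
  rw [uIcc_of_le hy] at hu
  rw [min_eq_left hu.2]

/-- **`J'(y) = −2Φ(min(y,1))/y`** for `y > 0` (in particular `J` is `C¹` across `y = 1`).
[cite: Ramare2001LOneApproximateFormulae, Lemma 15 p. 259] -/
theorem hasDerivAt_vaalerJ
    (hΦ : Φ = fun u => Real.cos (π * u) / (Real.sinc (π * u) + Real.sinc (π * (1 - u))) + u)
    (hJ : J = fun y => 2 * ∫ u in y..1, Φ (min u 1) / u) {y : ℝ} (hy : 0 < y) :
    HasDerivAt J (-(2 * Φ (min y 1) / y)) y := by
  have hc := continuousOn_vaalerJIntegrand hΦ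
  have hsub : uIcc y 1 ⊆ Ioi (0:ℝ) := fun u hu => lt_of_lt_of_le (lt_min hy one_pos) hu.1
  have h1 : HasDerivAt (fun y => ∫ u in y..1, Φ (min u 1) / u) (-(Φ (min y 1) / y)) y :=
    intervalIntegral.integral_hasDerivAt_left (hc.mono hsub).intervalIntegrable
      (hc.stronglyMeasurableAtFilter isOpen_Ioi y hy) (hc.continuousAt (Ioi_mem_nhds hy))
  rw [hJ]
  refine (h1.const_mul 2).congr_deriv ?_
  ring

/-- `J ≥ 0` on `(0, ∞)`. [cite: Ramare2001LOneApproximateFormulae, Lemma 7 p. 253] -/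
theorem vaalerJ_nonneg
    (hΦ : Φ = fun u => Real.cos (π * u) / (Real.sinc (π * u) + Real.sinc (π * (1 - u))) + u)
    (hJ : J = fun y => 2 * ∫ u in y..1, Φ (min u 1) / u) {y : ℝ} (hy : 0 < y) : 0 ≤ J y := by
  rcases le_or_gt y 1 with h | h
  · rw [vaalerJ_eq hJ h]
    exact mul_nonneg two_pos.le (intervalIntegral.integral_nonneg h fun u hu =>
      div_nonneg (vaalerPhi_mem_Icc hΦ ⟨hy.le.trans hu.1, hu.2⟩).1 (hy.le.trans hu.1))
  · rw [vaalerJ_eq_zero hΦ hJ h.le]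

/-- **`J(y) = −2 log y − 2R(y)`** for `0 < y ≤ 1` (so `J(y) ≤ −2 log y`, Ramaré's Lemma 7).
[cite: Ramare2001LOneApproximateFormulae, Lemma 7 p. 253] -/
theorem vaalerJ_eq_log
    (hΦ : Φ = fun u => Real.cos (π * u) / (Real.sinc (π * u) + Real.sinc (π * (1 - u))) + u)
    (hJ : J = fun y => 2 * ∫ u in y..1, Φ (min u 1) / u)
    (hR : R = fun y => ∫ u in (min y 1)..1, (1 - Φ u) / u) {y : ℝ} (hy0 : 0 < y) (hy : y ≤ 1) :
    J y = -2 * Real.log y - 2 * R y := by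
  rw [vaalerJ_eq hJ hy, vaalerR_eq_of_le_one hR hy]
  have hpos : ∀ u ∈ uIcc y 1, 0 < u := fun u hu => by
    rw [uIcc_of_le hy] at hu; exact hy0.trans_le hu.1
  have hsplit : ∫ u in y..1, Φ u / u = (∫ u in y..1, u⁻¹) - ∫ u in y..1, (1 - Φ u) / u := by
    rw [← intervalIntegral.integral_sub]
    · refine intervalIntegral.integral_congr fun u hu => ?_
      have hu0 : u ≠ 0 := (hpos u hu).ne'
      rw [eq_sub_iff_add_eq, ← add_div, inv_eq_one_div]
      congr 1; ring
    · exact intervalIntegral.intervalIntegrable_inv (fun u hu => (hpos u hu).ne') continuousOn_id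
    · exact ((continuousOn_one_sub_vaalerPhi_div hΦ).mono
        (uIcc_subset_Icc ⟨hy0.le, hy⟩ ⟨zero_le_one, le_rfl⟩)).intervalIntegrable
  rw [hsplit, integral_inv_of_pos hy0 one_pos, one_div, Real.log_inv]
  ring

/-- `Σ_{m<N} log(m+1) = log N!`. [folklore] -/
private theorem sum_range_log_add_one (N : ℕ) :
    ∑ m ∈ Finset.range N, Real.log ((m:ℝ) + 1) = Real.log ((N ! : ℕ) : ℝ) := by
  induction N with
  | zero => simp
  | succ n ih =>
    rw [Finset.sum_range_succ, ih, Nat.factorial_succ, Nat.cast_mul,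
      Real.log_mul (Nat.cast_ne_zero.2 (Nat.succ_ne_zero n))
        (Nat.cast_ne_zero.2 (Nat.factorial_ne_zero n))]
    push_cast
    ring

/-- **The dual sum bound** (honest form of Ramaré's second smoothing, §VI p. 262): for `α ≥ 1` and
every `M`, `Σ_{1 ≤ m ≤ M} J(m/α) ≤ α − log α + (5 − log π)`.  Proof: `J(y) = −2 log y − 2R(y)`,
Stirling's lower bound for `log ⌊α⌋!` (Mathlib), and the Riemann-sum bound
`Σ_{m ≤ α} R(m/α) ≥ α∫₀¹R − sup R ≥ α/2 − 5/2` for the non-increasing `R`.  (Ramaré, using Lemma 10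
and `j ≥ −2 log|t| − 2(log 2π − 1)`, states the constant `−(log 2π − 1)`; see the module docstring.)
[cite: Ramare2001LOneApproximateFormulae, §VI p. 262 (second smoothing for even characters)] -/
theorem sum_vaalerJ_le
    (hΦ : Φ = fun u => Real.cos (π * u) / (Real.sinc (π * u) + Real.sinc (π * (1 - u))) + u)
    (hJ : J = fun y => 2 * ∫ u in y..1, Φ (min u 1) / u) {α : ℝ} (hα : 1 ≤ α) (M : ℕ) :
    ∑ m ∈ Finset.range M, J ((m + 1) / α) ≤ α - Real.log α + (5 - Real.log π) := by
  set R : ℝ → ℝ := fun y => ∫ u in (min y 1)..1, (1 - Φ u) / u with hR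
  set N := ⌊α⌋₊ with hN
  have hα0 : 0 < α := by linarith
  have hN1 : 1 ≤ N := by rw [hN, Nat.one_le_floor_iff]; exact hα
  have hN1' : (1:ℝ) ≤ N := by exact_mod_cast hN1
  have hNα : (N:ℝ) ≤ α := Nat.floor_le hα0.le
  have hαN : α < N + 1 := Nat.lt_floor_add_one α
  have hN0 : (0:ℝ) < N := by linarith
  -- Step 1: only the terms `m + 1 ≤ N` contribute
  have hJ0 : ∀ m : ℕ, N ≤ m → J ((m + 1) / α) = 0 := fun m hm =>
    vaalerJ_eq_zero hΦ hJ (by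
      rw [le_div_iff₀ hα0, one_mul]
      have : (N:ℝ) ≤ m := by exact_mod_cast hm
      linarith)
  have hJnn : ∀ m : ℕ, 0 ≤ J ((m + 1) / α) := fun m => vaalerJ_nonneg hΦ hJ (by positivity)
  have hred : ∑ m ∈ Finset.range M, J ((m + 1) / α) ≤ ∑ m ∈ Finset.range N, J ((m + 1) / α) := by
    calc ∑ m ∈ Finset.range M, J ((m + 1) / α)
        = ∑ m ∈ Finset.range (min M N), J ((m + 1) / α) := by
          symm
          refine Finset.sum_subset (Finset.range_mono (min_le_left _ _)) fun m hm hmn => ?_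
          simp only [Finset.mem_range, not_lt] at hm hmn
          exact hJ0 m (by omega)
      _ ≤ ∑ m ∈ Finset.range N, J ((m + 1) / α) :=
          Finset.sum_le_sum_of_subset_of_nonneg (Finset.range_mono (min_le_right _ _))
            fun m _ _ => hJnn m
  refine hred.trans ?_
  -- Step 2: `J(m/α) = −2 log(m/α) − 2R(m/α)` for `m ≤ N`
  have hterm : ∀ m ∈ Finset.range N,
      J ((m + 1) / α) = -2 * Real.log (((m:ℝ) + 1) / α) - 2 * R (((m:ℝ) + 1) / α) := by
    intro m hm
    simp only [Finset.mem_range] at hm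
    refine vaalerJ_eq_log hΦ hJ hR (by positivity) ?_
    rw [div_le_one hα0]
    have : (m:ℝ) + 1 ≤ N := by exact_mod_cast hm
    linarith
  rw [Finset.sum_congr rfl hterm, Finset.sum_sub_distrib, ← Finset.mul_sum, ← Finset.mul_sum]
  -- Step 3: the logarithmic sum is `log N! − N log α`
  have hlogsum : ∑ m ∈ Finset.range N, Real.log (((m:ℝ) + 1) / α)
      = Real.log ((N ! : ℕ) : ℝ) - N * Real.log α := by
    have h1 : ∀ m ∈ Finset.range N, Real.log (((m:ℝ) + 1) / α) = Real.log ((m:ℝ) + 1) - Real.log α :=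
      fun m _ => Real.log_div (by positivity) hα0.ne'
    rw [Finset.sum_congr rfl h1, Finset.sum_sub_distrib, Finset.sum_const, Finset.card_range,
      nsmul_eq_mul, sum_range_log_add_one]
  -- Step 4: `Σ_{m ≤ N} R(m/α) ≥ α/2 − 5/2`
  have hRc := continuousOn_vaalerR hΦ hR
  have hRi : ∀ {a b : ℝ}, 0 ≤ a → 0 ≤ b → IntervalIntegrable R volume a b := fun {a b} ha hb =>
    (hRc.mono (fun x hx => le_trans (le_min ha hb) hx.1)).intervalIntegrable
  have hRsum : α / 2 - 5 / 2 ≤ ∑ m ∈ Finset.range N, R (((m:ℝ) + 1) / α) := by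
    have hanti : AntitoneOn (fun t => R (t / α)) (Icc (1:ℝ) (1 + N)) := by
      intro t ht t' ht' htt'
      exact vaalerR_antitoneOn hΦ hR (show (0:ℝ) ≤ t / α from div_nonneg (by linarith [ht.1]) hα0.le)
        (show (0:ℝ) ≤ t' / α from div_nonneg (by linarith [ht'.1]) hα0.le)
        (div_le_div_of_nonneg_right htt' hα0.le)
    have h1 := hanti.integral_le_sum
    have h2 : ∫ t in (1:ℝ)..1 + N, R (t / α) = α * ∫ u in (1 / α)..((1 + N) / α), R u := by
      rw [intervalIntegral.integral_comp_div R hα0.ne', smul_eq_mul]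
    have h1le : (1:ℝ) ≤ (1 + N) / α := by rw [le_div_iff₀ hα0]; linarith
    have h3 : ∫ u in (1:ℝ)..((1 + N) / α), R u = 0 := by
      rw [intervalIntegral.integral_congr (g := fun _ => (0:ℝ)) ?_]
      · simp
      · intro u hu
        rw [uIcc_of_le h1le] at hu
        exact vaalerR_eq_zero hR hu.1
    have h4 : ∫ u in (0:ℝ)..(1 / α), R u ≤ 5 / 2 * (1 / α) := by
      have := intervalIntegral.integral_mono_on (by positivity : (0:ℝ) ≤ 1 / α)
        (hRi le_rfl (by positivity)) intervalIntegrable_const (fun u hu => vaalerR_le hΦ hR hu.1)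
      rwa [intervalIntegral.integral_const, smul_eq_mul, sub_zero, mul_comm] at this
    have h5 : ∫ u in (0:ℝ)..1, R u = 1 / 2 := integral_vaalerR hΦ hR
    have hadd1 := intervalIntegral.integral_add_adjacent_intervals
      (hRi le_rfl (by positivity) : IntervalIntegrable R volume 0 (1 / α))
      (hRi (by positivity) zero_le_one : IntervalIntegrable R volume (1 / α) 1)
    have hadd2 := intervalIntegral.integral_add_adjacent_intervals
      (hRi (by positivity) zero_le_one : IntervalIntegrable R volume (1 / α) 1)
      (hRi zero_le_one (by positivity) : IntervalIntegrable R volume 1 ((1 + N) / α))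
    have h6 : ∑ i ∈ Finset.range N, R ((1 + (i:ℝ)) / α) = ∑ m ∈ Finset.range N, R (((m:ℝ) + 1) / α) :=
      Finset.sum_congr rfl fun i _ => by rw [add_comm]
    have hI : 1 / 2 - 5 / 2 * (1 / α) ≤ ∫ u in (1 / α)..((1 + N) / α), R u := by linarith
    have hkey : α * (1 / 2 - 5 / 2 * (1 / α)) ≤ α * ∫ u in (1 / α)..((1 + N) / α), R u :=
      mul_le_mul_of_nonneg_left hI hα0.le
    have hE : α * (1 / 2 - 5 / 2 * (1 / α)) = α / 2 - 5 / 2 := by field_simp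
    linarith [h1, h2, h6]
  -- Step 5: Stirling and bookkeeping
  have hst := Stirling.le_log_factorial_stirling (n := N) (by omega)
  have hi : (N:ℝ) * (Real.log α - Real.log N) ≤ α - N := by
    have h := Real.log_le_sub_one_of_pos (show 0 < α / N by positivity)
    rw [Real.log_div hα0.ne' hN0.ne'] at h
    have := mul_le_mul_of_nonneg_left h hN0.le
    have hE : (N:ℝ) * (α / N - 1) = α - N := by field_simp
    linarith
  have hii : Real.log α - Real.log N ≤ Real.log 2 := by
    have h := Real.log_le_log hα0 (show α ≤ 2 * N by linarith)
    rw [Real.log_mul two_ne_zero hN0.ne'] at h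
    linarith
  have h2π : Real.log (2 * π) = Real.log 2 + Real.log π :=
    Real.log_mul two_ne_zero Real.pi_pos.ne'
  rw [hlogsum]
  rw [h2π] at hst
  nlinarith [hRsum, hst, hi, hii]

end Dual

end Literature.Analysis.Fourier
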